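import Mathlib.Algebra.Polynomial.Eval.Defs
import Mathlib.Data.Finset.Basic
import Literature.Computability.Complexity.TimeBounds
import Literature.Computability.Complexity.BoolEncodings
import Literature.Computability.Complexity.CNF
import Literature.Computability.MetaComplexity.ProofSystems
import HarnessLib

-- provenance: harness21/H21/H21/Prelude/CplxMeta/Frege.lean @ af542ab (interim HEAD d8f2665); M5 mechanical rewrite
/-!
# Frege and Extended Frege proof systems

Trunk T-CPLX-META (G14, CplxMeta), concept C10 of the outline (`H21/Outlines/CplxMeta.md`,
design D2); realises the Frege / Extended Frege / bounded-depth part of the inventory notion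
`frege_ef_resolution`.

A *Frege system* (Cook–Reckhow) is a finite list of schematic inference rules over propositional
formulas which is sound and implicationally complete; a derivation is a finite sequence of
formulas each of which is a hypothesis or follows from earlier lines by a substitution instance
of a rule. *Extended Frege* additionally allows extension axioms `p ↔ ψ` introducing a fresh
variable `p` as an abbreviation. We define these over G01's `PropForm ℕ`
(basis `var/const/neg/conj/disj`), together with proof size, polynomial boundedness,
p-simulation between Frege systems (with polynomial-time proof translations w.r.t. G01's
`encodingPropForm.listBool`), bounded-(alternation-)depth proofs, one concrete textbook system
`textbookFrege`, and the bridge to the abstract Cook–Reckhow layer of `ProofSystems.lean`.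

## Sources

* S. A. Cook, R. A. Reckhow, *The relative efficiency of propositional proof systems*,
  J. Symbolic Logic 44 (1979): §2 (Frege systems, implicational completeness, Thm. (Reckhow)
  that all Frege systems p-simulate each other), §4 (extended Frege).
* J. Krajíček, *Bounded arithmetic, propositional logic, and complexity theory* (CUP 1995),
  Ch. 4, §4.4 (Frege, EF), Def. 4.3.2 ff. (depth of a formula).
* S. R. Buss, *An introduction to proof theory*, Ch. I of the *Handbook of Proof Theory* (1998),
  §1.1–1.2 (Frege systems), and S. R. Buss, *Propositional proof complexity: an introduction*
  (1999), §2.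
* J. R. Shoenfield, *Mathematical Logic* (1967), §2.6 / §3.1: the propositional axiom scheme
  `¬A ∨ A` and the rules expansion, contraction, associativity, cut; the tautology theorem
  (completeness) — source of `textbookFrege`.

## Design choices

* `PropForm.subst`, `PropForm.vars`, `PropForm.biimp`, `PropForm.altDepth` (and their lemmas) are
  deliberate dot-notation extensions of G01's `Literature.Computability.Complexity.PropForm` and live in that namespace;
  G01's `CNF.lean` has `CNF.vars` but no `PropForm.vars`/`PropForm.subst`.
* Frege systems are DATA (`FregeSystem` = a list of `FregeRule`s over `PropForm ℕ`; the variables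
  of a rule act as metavariables, instances are obtained by `PropForm.subst`). Soundness and
  implicational completeness are *predicates* (`FregeSystem.IsSound`,
  `FregeSystem.IsImplicationallyComplete`, `IsFrege`), never structure fields, so that concrete
  systems (`textbookFrege`) are definable without `sorry`. The four predicates whose only
  argument is the rule list (`FregeSystem.IsSound`, `.IsImplicationallyComplete`,
  `.IsPolyBounded`, `.IsEFPolyBounded`) take `F` as an explicit binder rather than through the
  section `variable`, so that they read as what they are — definitions in hypothesis form
  (Cook–Reckhow's Defs. 2.1, 2.2, 1.3), not closed named facts awaiting a `_holds` discharge
  (D-0014); their universal closures are false (`FregeProofs.lean`, `EFSoundness.lean`) and,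
  for Frege systems, polynomial boundedness is the open question of Cook–Reckhow §1.
* Derivations are lists of lines validated by a `Prop` (`FregeSystem.IsDerivation`): line `k` is
  a hypothesis or the conclusion of a substitution instance of a rule all of whose premises occur
  among the earlier lines `π.take k`. Sequence-like size = dag-like size.
* The connective basis is fixed to `PropForm`'s; Reckhow's basis independence is cited, not
  formalised. p-simulation between Frege systems (`FregeSystem.PSimulates`) is stated at the math
  level with `PolyTimeComputable` proof translations, so no string-level proof checker is needed.
* `PropForm.altDepth` is the alternation depth (unbounded fan-in depth): maximal number of blocks
  of equal connectives along a branch, nested equal connectives counting once; variables and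
  constants have depth `0`, and `¬` blocks count (Krajíček 1995, §4.3).
* Mathlib has no Frege systems, Hilbert-style propositional calculi as data, or p-simulation
  (searched `Frege`, `Hilbert`, `pSimulat`, `implicationally`); Mathlib's `ModelTheory` syntax is
  first-order and carries no proof calculus.
-/

namespace Literature.Computability.Complexity.PropForm

/-! ### Syntax extensions of `PropForm`: substitution, variables, biimplication, depth -/

universe u

variable {ν : Type u}

/-- Simultaneous substitution of formulas for variables: `φ.subst σ` replaces every variable
`x` of `φ` by `σ x`. (Dot-extension of G01's `Literature.Computability.Complexity.PropForm`.)
[Cook–Reckhow 1979, §2 (substitution instances of rules); Buss 1998, §1.1] [cite: CookReckhow1979, §2 (substitution instances of rules] -/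
def subst (σ : ν → PropForm ν) : PropForm ν → PropForm ν
  | var x => σ x
  | const b => const b
  | neg φ => neg (φ.subst σ)
  | conj φ ψ => conj (φ.subst σ) (ψ.subst σ)
  | disj φ ψ => disj (φ.subst σ) (ψ.subst σ)

/-- The finite set of variables occurring in a formula (name parallels `CNF.vars` and Mathlib's
`MvPolynomial.vars`). (Dot-extension of G01's `Literature.Computability.Complexity.PropForm`.)
[Cook–Reckhow 1979, §4 (fresh variables for extension); Buss 1998, §1.1] [cite: CookReckhow1979, §4 (fresh variables for extension] -/
def vars [DecidableEq ν] : PropForm ν → Finset ν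
  | var x => {x}
  | const _ => ∅
  | neg φ => φ.vars
  | conj φ ψ => φ.vars ∪ ψ.vars
  | disj φ ψ => φ.vars ∪ ψ.vars

/-- Biimplication `a ↔ b`, defined in the basis `¬, ∧, ∨` as `(¬a ∨ b) ∧ (a ∨ ¬b)`.
(Dot-extension of G01's `Literature.Computability.Complexity.PropForm`.) [Cook–Reckhow 1979, §4 (extension axiom
`p ≡ ψ`); Krajíček 1995, §4.4] [cite: CookReckhow1979, §4 (extension axiom  p ≡ ψ] -/
def biimp (a b : PropForm ν) : PropForm ν :=
  conj (disj (neg a) b) (disj a (neg b))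

/-- Auxiliary for `altDepth`: the alternation depth of `φ` when it occurs directly below a
connective with tag `c` (`1` = `neg`, `2` = `conj`, `3` = `disj`, any other value = no parent);
a connective equal to its parent's does not open a new block. [Krajíček 1995, §4.3 (depth)] [folklore] -/
def altDepthAux : ℕ → PropForm ν → ℕ
  | _, var _ => 0
  | _, const _ => 0
  | c, neg φ => altDepthAux 1 φ + (if c = 1 then 0 else 1)
  | c, conj φ ψ => max (altDepthAux 2 φ) (altDepthAux 2 ψ) + (if c = 2 then 0 else 1)
  | c, disj φ ψ => max (altDepthAux 3 φ) (altDepthAux 3 ψ) + (if c = 3 then 0 else 1)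

/-- The alternation depth (unbounded fan-in depth) of a formula: the maximal number of maximal
blocks of equal connectives on a root-to-leaf branch, nested equal connectives counting once
(so `(a ∨ b) ∨ c` has depth `1`, `¬¬a` depth `1`, `a ∧ (b ∨ c)` depth `2`); variables and
constants have depth `0`. This is the depth measure of bounded-depth Frege.
(Dot-extension of G01's `Literature.Computability.Complexity.PropForm`.) [Krajíček 1995, Def. 4.3.2 ff.;
Buss 1999, §2 (depth of unbounded fan-in formulas)] [cite: Buss1999, §2 (depth of unbounded fan-in formulas] -/
def altDepth (φ : PropForm ν) : ℕ :=
  altDepthAux 0 φ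

/-- Substitution commutes with evaluation: evaluating `φ.subst σ` under `τ` is evaluating `φ`
under `x ↦ ⟦σ x⟧τ`. [Buss 1998, §1.1; Cook–Reckhow 1979, §2] [cite: Buss1998, §1.1] -/
@[simp] theorem eval_subst (σ : ν → PropForm ν) (τ : ν → Bool) (φ : PropForm ν) :
    (φ.subst σ).eval τ = φ.eval fun x => (σ x).eval τ := by
  induction φ <;> simp_all [subst, eval]

/-- Substituting each variable by itself is the identity. [Buss 1998, §1.1] [cite: Buss1998, §1.1] -/
@[simp] theorem subst_var (φ : PropForm ν) : φ.subst var = φ := by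
  induction φ <;> simp_all [subst]

/-- Semantics of biimplication. [Cook–Reckhow 1979, §4] [cite: CookReckhow1979, §4] -/
@[simp] theorem eval_biimp (σ : ν → Bool) (a b : PropForm ν) :
    (biimp a b).eval σ = (a.eval σ == b.eval σ) := by
  cases ha : a.eval σ <;> cases hb : b.eval σ <;> simp [biimp, eval, ha, hb]

/-- A tautology stays a tautology under substitution. [Cook–Reckhow 1979, §2] [cite: CookReckhow1979, §2] -/
theorem IsTautology.subst {φ : PropForm ν} (h : φ.IsTautology) (σ : ν → PropForm ν) :
    (φ.subst σ).IsTautology :=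
  fun τ => by rw [eval_subst]; exact h _

/-- The auxiliary depth is bounded by the size. [Krajíček 1995, §4.3] [folklore] -/
theorem altDepthAux_le_size (c : ℕ) (φ : PropForm ν) : altDepthAux c φ ≤ φ.size := by
  induction φ generalizing c with
  | var _ => simp [altDepthAux]
  | const _ => simp [altDepthAux]
  | neg φ ih =>
    have := ih 1
    simp only [altDepthAux, size]; split_ifs <;> omega
  | conj φ ψ ihφ ihψ =>
    have := ihφ 2; have := ihψ 2
    simp only [altDepthAux, size]; split_ifs <;> omega
  | disj φ ψ ihφ ihψ =>
    have := ihφ 3; have := ihψ 3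
    simp only [altDepthAux, size]; split_ifs <;> omega

/-- The alternation depth of a formula is at most its size. [Krajíček 1995, §4.3] [folklore] -/
theorem altDepth_le_size (φ : PropForm ν) : φ.altDepth ≤ φ.size :=
  altDepthAux_le_size 0 φ

end Literature.Computability.Complexity.PropForm

namespace Literature.Computability.MetaComplexity

open _root_.Computability Complexity

/-! ### Frege rules and systems -/

/-- A schematic Frege rule `premises ⊢ conclusion` over `PropForm ℕ`; the variables occurring in
it act as metavariables, and an *instance* of the rule is obtained by a substitution
`PropForm.subst σ`. A rule with no premises is an axiom scheme.
[Cook–Reckhow 1979, §2 (Def. of Frege rule); Buss 1998, §1.1] [cite: CookReckhow1979, §2 (Def. of Frege rule] -/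
structure FregeRule where
  /-- the premises `A₁, …, Aₖ` of the rule scheme -/
  premises : List (PropForm ℕ)
  /-- the conclusion `B` of the rule scheme -/
  conclusion : PropForm ℕ
  deriving DecidableEq, Repr

/-- A Frege rule is *sound* if its conclusion is a semantic consequence of its premises (hence,
by `PropForm.eval_subst`, so is every substitution instance).
[Cook–Reckhow 1979, §2 (sound rule); Buss 1998, §1.1] [cite: CookReckhow1979, §2 (sound rule] -/
def FregeRule.IsSound (r : FregeRule) : Prop :=
  ∀ σ : ℕ → Bool, (∀ p ∈ r.premises, p.eval σ = true) → r.conclusion.eval σ = true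

/-- A (candidate) Frege system: a finite list of schematic rules over `PropForm ℕ`. Soundness and
implicational completeness — which make it a Frege system in Cook–Reckhow's sense — are the
predicate `IsFrege`, not fields, so that concrete systems are plain data.
[Cook–Reckhow 1979, §2 (Def. of Frege system); Krajíček 1995, Def. 4.4.1] [cite: CookReckhow1979, §2 (Def. of Frege system] -/
structure FregeSystem where
  /-- the finite list of inference rule schemes -/
  rules : List FregeRule
  deriving Repr

namespace FregeSystem

variable (F : FregeSystem)

/-- `F.IsSound`: the rule list `F` is *sound* if every rule is. A predicate on the data `F`
(Cook–Reckhow build the side condition `C₁, …, Cₙ ⊨ D` into their notion of Frege rule,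
Def. 2.1; here rules are plain data and the condition is this hypothesis, verified per system,
e.g. `isSound_textbookFrege`); the binder `F` is explicit so that the definition is not read as a
closed statement. [Cook–Reckhow 1979, §2, Def. 2.1] [cite: CookReckhow1979, §2 Def. 2.1] -/
def IsSound (F : FregeSystem) : Prop :=
  ∀ r ∈ F.rules, r.IsSound

/-- `F.IsInferred prev θ`: the formula `θ` follows from the list of earlier lines `prev` by one
application of a rule of `F`, i.e. there are a rule `r` and a substitution `σ` with
`r.conclusion.subst σ = θ` and every premise instance `p.subst σ` occurring in `prev`.
[Cook–Reckhow 1979, §2 (inference by a substitution instance of a rule)] [cite: CookReckhow1979, §2 (inference by a substitution instance] -/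
def IsInferred (prev : List (PropForm ℕ)) (θ : PropForm ℕ) : Prop :=
  ∃ r ∈ F.rules, ∃ σ : ℕ → PropForm ℕ,
    r.conclusion.subst σ = θ ∧ ∀ p ∈ r.premises, p.subst σ ∈ prev

/-- `F.IsDerivation Γ π`: the sequence of lines `π` is an `F`-derivation from the hypotheses
`Γ` — every line `π[k]` is a hypothesis or is inferred by a rule instance from the earlier lines
`π.take k`. [Cook–Reckhow 1979, §2 (Def. of derivation); Buss 1998, §1.1] [cite: CookReckhow1979, §2 (Def. of derivation] -/
def IsDerivation (Γ : Set (PropForm ℕ)) (π : List (PropForm ℕ)) : Prop :=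
  ∀ (k : ℕ) (hk : k < π.length), π[k] ∈ Γ ∨ F.IsInferred (π.take k) π[k]

/-- `F.Derives Γ φ` (`Γ ⊢_F φ`): some `F`-derivation from `Γ` ends with `φ`.
[Cook–Reckhow 1979, §2] [cite: CookReckhow1979, §2] -/
def Derives (Γ : Set (PropForm ℕ)) (φ : PropForm ℕ) : Prop :=
  ∃ π, F.IsDerivation Γ π ∧ π.getLast? = some φ

/-- `F.IsProofOf π φ`: `π` is an `F`-proof of `φ`, i.e. a derivation from no hypotheses whose
last line is `φ`. [Cook–Reckhow 1979, §2; Krajíček 1995, Def. 4.4.1] [cite: CookReckhow1979, §2] -/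
def IsProofOf (π : List (PropForm ℕ)) (φ : PropForm ℕ) : Prop :=
  F.IsDerivation ∅ π ∧ π.getLast? = some φ

/-- `F.Provable φ` (`⊢_F φ`): `φ` has an `F`-proof. [Cook–Reckhow 1979, §2] [cite: CookReckhow1979, §2] -/
def Provable (φ : PropForm ℕ) : Prop :=
  ∃ π, F.IsProofOf π φ

/-- `F.IsImplicationallyComplete`: the rule list `F` is *implicationally complete* — whenever
`φ` is a semantic consequence of finitely many formulas `Γ`, it is `F`-derivable from `Γ`
("An inference system `F` is implicationally complete if `A₁, …, Aₙ ⊢_F B` whenever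
`A₁, …, Aₙ ⊨ B`", Def. 2.2). A predicate on `F` (explicit binder), verified per system, e.g.
`isFrege_textbookFrege`. [Cook–Reckhow 1979, §2, Def. 2.2; Krajíček 1995, Def. 4.4.1]
[cite: CookReckhow1979, §2 Def. 2.2] -/
def IsImplicationallyComplete (F : FregeSystem) : Prop :=
  ∀ (Γ : Finset (PropForm ℕ)) (φ : PropForm ℕ),
    (∀ σ : ℕ → Bool, (∀ ψ ∈ Γ, ψ.eval σ = true) → φ.eval σ = true) → F.Derives ↑Γ φ

end FregeSystem

/-- `IsFrege F`: `F` is a *Frege system* in the sense of Cook–Reckhow — a finite set of sound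
rules which is implicationally complete. [Cook–Reckhow 1979, §2 (Def. of Frege system);
Krajíček 1995, Def. 4.4.1; Buss 1998, §1.1] [cite: CookReckhow1979, §2 (Def. of Frege system] -/
def IsFrege (F : FregeSystem) : Prop :=
  F.IsSound ∧ F.IsImplicationallyComplete

/-- The number of lines (steps) of a derivation. [Cook–Reckhow 1979, §2; Buss 1998, §1.1] [cite: CookReckhow1979, §2] -/
def proofLines (π : List (PropForm ℕ)) : ℕ :=
  π.length

/-- The size of a derivation: the total number of symbols, i.e. the sum of the sizes
(`PropForm.size`, node count) of its lines. [Cook–Reckhow 1979, §1–2 (length of a proof);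
Krajíček 1995, §4.4] [cite: CookReckhow1979, §1–2 (length of a proof] -/
def proofSize (π : List (PropForm ℕ)) : ℕ :=
  (π.map PropForm.size).sum

namespace FregeSystem

variable (F : FregeSystem)

/-- `F.IsPolyBounded`: the inference system `F` is *polynomially bounded* — there is a
polynomial `p` such that every tautology `φ` has an `F`-proof of size (`proofSize`, the total
symbol count of its lines) at most `p φ.size`. This is Cook–Reckhow's Def. 1.3 ("the proof
system is polynomially bounded iff there is a polynomial `p(n)` such that for all `y ∈ L` there
is `x` such that `y = f(x)` and `|x| ≤ p(|y|)`") specialised to the inference system of a rule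
list (§2, Defs. 2.1–2.2) with the symbol-count length measure. It is a DEFINITION with the
explicit parameter `F` — a hypothesis `(h : F.IsPolyBounded)` for its users — not a statement
of the source: over all rule lists it fails (a rule-less system proves nothing) and it holds of
unsound systems such as the scheme `⊢ A` (`FregeProofs.lean`), while for Frege systems
(`IsFrege F`) whether it ever holds is the OPEN question the source poses and conjectures to have
a negative answer (§1, after Prop. 1.4: "Are any conventional propositional proof systems
polynomially bounded? … We conjecture that the answer is always no"). By Cor. 2.4 one Frege
system is polynomially bounded iff all are (in the tree:
`Literature.Computability.Complexity.isPolyBounded_iff_of_isFrege`), a polynomially bounded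
Frege system would give `NP = coNP` (Props. 1.1, 1.4;
`Literature.Computability.Complexity.NP_eq_coNP_of_isPolyBounded`), and the open problem
`Literature.Computability.Complexity.EFNotPolyBounded` (pnp.S32) denies it for every Frege
system. [Cook–Reckhow 1979, §1, Def. 1.3 and the question after Prop. 1.4; §2, Cor. 2.4;
Krajíček 1995, §4.1 (Fundamental problem, Thm. 4.1.2), §4.4]
[cite: CookReckhow1979, §1 Def. 1.3 (polynomially bounded), §2 Cor. 2.4] -/
def IsPolyBounded (F : FregeSystem) : Prop :=
  ∃ p : Polynomial ℕ, ∀ φ : PropForm ℕ, φ.IsTautology →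
    ∃ π, F.IsProofOf π φ ∧ proofSize π ≤ p.eval φ.size

/-- `F₁.PSimulates F₂`: the Frege system `F₁` *p-simulates* `F₂` — there is a proof translation
`f` on sequences of formulas, computable in polynomial time w.r.t. G01's string encoding
`encodingPropForm.listBool`, sending every `F₂`-proof of `φ` to an `F₁`-proof of `φ`
(Cook–Reckhow's Def. 1.5 specialised to Frege systems over one language, at the math level).
[Cook–Reckhow 1979, §1 Def. 1.5, §2; Krajíček 1995, p. 28, Def. 4.1.3(b) (p-simulation `≤ₚ`; Def. 4.1.3(a) is
the weaker size-only quasi-order `≤`)] [cite: CookReckhow1979, §1 Def. 1.5  §2] [cite: Krajicek1995, Def 4.1.3(b)] -/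
def PSimulates (F₁ F₂ : FregeSystem) : Prop :=
  ∃ f : List (PropForm ℕ) → List (PropForm ℕ),
    PolyTimeComputable encodingPropForm.listBool.encode encodingPropForm.listBool.encode f ∧
    ∀ π φ, F₂.IsProofOf π φ → F₁.IsProofOf (f π) φ

/-! ### Extended Frege and bounded-depth Frege -/

/-- `IsExtensionAxiom φ prev θ`: the line `θ` is an admissible *extension axiom* at a point of
an extended-Frege proof of `φ` where the earlier lines are `prev`: `θ = (p ↔ ψ)`
(`PropForm.biimp (var p) ψ`) for a variable `p` that occurs neither in `ψ`, nor in the proved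
formula `φ`, nor in any earlier line. [Cook–Reckhow 1979, §4 (extension rule);
Krajíček 1995, p. 53, Def. 4.5.2 (conditions 1–2: `q` not in `ψ`, not in any earlier `θ_j`, not in
the last formula `θ_k`; print abbreviates `≡` as `(α ∧ β) ∨ (¬α ∧ ¬β)`, here `PropForm.biimp`)]
[cite: CookReckhow1979, §4 (extension rule] [cite: Krajicek1995, Def 4.5.2] -/
def IsExtensionAxiom (φ : PropForm ℕ) (prev : List (PropForm ℕ)) (θ : PropForm ℕ) : Prop :=
  ∃ (p : ℕ) (ψ : PropForm ℕ), θ = PropForm.biimp (PropForm.var p) ψ ∧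
    p ∉ ψ.vars ∧ p ∉ φ.vars ∧ ∀ χ ∈ prev, p ∉ χ.vars

/-- `F.IsEFDerivation φ π`: `π` is an extended-Frege (`EF`) derivation over `F` relative to the
target formula `φ` — every line is inferred by a rule instance from earlier lines or is an
extension axiom `p ↔ ψ` with `p` fresh (not in `ψ`, `φ`, or earlier lines).
[Cook–Reckhow 1979, §4; Krajíček 1995, p. 53, Def. 4.5.2] [cite: CookReckhow1979, §4] [cite: Krajicek1995, Def 4.5.2] -/
def IsEFDerivation (φ : PropForm ℕ) (π : List (PropForm ℕ)) : Prop :=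
  ∀ (k : ℕ) (hk : k < π.length),
    F.IsInferred (π.take k) π[k] ∨ IsExtensionAxiom φ (π.take k) π[k]

/-- `F.IsEFProofOf π φ`: `π` is an extended-Frege proof of `φ` over `F`.
[Cook–Reckhow 1979, §4; Krajíček 1995, p. 53, Def. 4.5.2] [cite: CookReckhow1979, §4] [cite: Krajicek1995, Def 4.5.2] -/
def IsEFProofOf (π : List (PropForm ℕ)) (φ : PropForm ℕ) : Prop :=
  F.IsEFDerivation φ π ∧ π.getLast? = some φ

/-- `F.IsEFPolyBounded`: extended Frege over the rule list `F` is polynomially bounded — there is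
a polynomial `p` such that every tautology `φ` has an `EF`-proof of size (`proofSize`) at most
`p φ.size`: Cook–Reckhow's Def. 1.3 applied to the extended Frege system `eF` of §4 (Def. 4.1).
A DEFINITION with the explicit parameter `F` (hypothesis form), not a statement of the source:
it fails over the rule-less list and, for Frege systems, it is the negation of the open problem
`Literature.Computability.Complexity.EFNotPolyBounded` (pnp.S32), robust in `F` by Cor. 4.7;
see `EFSoundness.lean` for Prop. 4.2 (soundness of `eF`) and the status discussion.
[Cook–Reckhow 1979, §1 Def. 1.3, §4 Def. 4.1, Cor. 4.7; Krajíček 1995, Def. 4.5.2, §4.5]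
[cite: CookReckhow1979, §1 Def. 1.3 (polynomially bounded), §4 Def. 4.1] -/
def IsEFPolyBounded (F : FregeSystem) : Prop :=
  ∃ p : Polynomial ℕ, ∀ φ : PropForm ℕ, φ.IsTautology →
    ∃ π, F.IsEFProofOf π φ ∧ proofSize π ≤ p.eval φ.size

/-- `F.IsDepthProofOf d π φ`: `π` is an `F`-proof of `φ` all of whose lines have alternation
depth (`PropForm.altDepth`) at most `d` — a depth-`d` (bounded-depth, `AC⁰`-) Frege proof.
[Krajíček 1995, §4.3 and §12 (constant-depth Frege); Buss 1999, §2] [cite: Buss1999, §2] -/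
def IsDepthProofOf (d : ℕ) (π : List (PropForm ℕ)) (φ : PropForm ℕ) : Prop :=
  F.IsProofOf π φ ∧ ∀ ψ ∈ π, ψ.altDepth ≤ d

end FregeSystem

/-! ### A concrete textbook Frege system -/

section Textbook

open Complexity.PropForm

/-- `textbookFrege`: Shoenfield's propositional calculus for the basis `¬, ∨`, extended by
definitional axiom schemes for the primitive connectives `conj` and `const` of `PropForm`.
With metavariables `A = var 0`, `B = var 1`, `C = var 2` and `X → Y` read as `¬X ∨ Y`, the rules
are, in order:
* (propositional axiom) `⊢ ¬A ∨ A`;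
* (expansion) `A ⊢ B ∨ A`; (contraction) `A ∨ A ⊢ A`;
  (associativity) `A ∨ (B ∨ C) ⊢ (A ∨ B) ∨ C`; (cut) `A ∨ B, ¬A ∨ C ⊢ B ∨ C`
  — Shoenfield 1967, §2.6 (the propositional axioms and rules of a first-order theory), whose
  completeness for tautological consequence in `¬, ∨` is the tautology theorem, §3.1;
* (conjunction, definitional) `⊢ (A ∧ B) → ¬(¬A ∨ ¬B)` and `⊢ ¬(¬A ∨ ¬B) → (A ∧ B)`, i.e.
  `⊢ ¬(A ∧ B) ∨ ¬(¬A ∨ ¬B)` and `⊢ ¬¬(¬A ∨ ¬B) ∨ (A ∧ B)` (Shoenfield §3.1 treats `∧` as the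
  abbreviation `¬(¬A ∨ ¬B)`; as `conj` is primitive here we add both directions of the defining
  equivalence as axiom schemes, cf. Buss 1998, §1.1);
* (constants) `⊢ const true` and `⊢ ¬(const false)`.
All rules are sound, and the system is implicationally complete (`isFrege_textbookFrege`):
Shoenfield's tautology theorem for `¬, ∨` plus the definitional axioms, which make every formula
provably equivalent to its `¬, ∨`-translation. [Shoenfield 1967, *Mathematical Logic*, §2.6,
§3.1 (tautology theorem); Buss 1998, §1.1; Cook–Reckhow 1979, §2] [cite: Shoenfield1967, §2.6 (the propositional axioms and rules] -/
def textbookFrege : FregeSystem where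
  rules :=
    [ -- propositional axiom `¬A ∨ A`
      ⟨[], disj (neg (var 0)) (var 0)⟩,
      -- expansion `A ⊢ B ∨ A`
      ⟨[var 0], disj (var 1) (var 0)⟩,
      -- contraction `A ∨ A ⊢ A`
      ⟨[disj (var 0) (var 0)], var 0⟩,
      -- associativity `A ∨ (B ∨ C) ⊢ (A ∨ B) ∨ C`
      ⟨[disj (var 0) (disj (var 1) (var 2))], disj (disj (var 0) (var 1)) (var 2)⟩,
      -- cut `A ∨ B, ¬A ∨ C ⊢ B ∨ C`
      ⟨[disj (var 0) (var 1), disj (neg (var 0)) (var 2)], disj (var 1) (var 2)⟩,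
      -- `⊢ ¬(A ∧ B) ∨ ¬(¬A ∨ ¬B)`
      ⟨[], disj (neg (conj (var 0) (var 1))) (neg (disj (neg (var 0)) (neg (var 1))))⟩,
      -- `⊢ ¬¬(¬A ∨ ¬B) ∨ (A ∧ B)`
      ⟨[], disj (neg (neg (disj (neg (var 0)) (neg (var 1))))) (conj (var 0) (var 1))⟩,
      -- `⊢ ⊤`
      ⟨[], const true⟩,
      -- `⊢ ¬⊥`
      ⟨[], neg (const false)⟩ ]

/-- The rules of `textbookFrege` are sound (a finite truth-table check).
[Shoenfield 1967, §2.6; Cook–Reckhow 1979, §2] [cite: Shoenfield1967, §2.6] -/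
theorem isSound_textbookFrege : textbookFrege.IsSound := by
  intro r hr σ hp
  simp only [textbookFrege, List.mem_cons, List.not_mem_nil, or_false] at hr
  rcases hr with rfl | rfl | rfl | rfl | rfl | rfl | rfl | rfl | rfl <;>
    simp only [List.mem_cons, List.not_mem_nil, or_false, forall_eq_or_imp, forall_eq,
      eval] at hp ⊢ <;>
    cases h0 : σ 0 <;> cases h1 : σ 1 <;> cases h2 : σ 2 <;> simp_all

/-- `textbookFrege` is a Frege system: sound (`isSound_textbookFrege`) and implicationally
complete — the completeness half is Shoenfield's tautology theorem (extended to hypotheses and to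
the definitional axioms for `conj`, `const`), a known theorem recorded with `sorry`.
[Shoenfield 1967, §3.1 (tautology theorem); Cook–Reckhow 1979, §2] [cite: Shoenfield1967, §3.1 (tautology theorem] -/
def isFrege_textbookFrege : Prop :=
  IsFrege textbookFrege

/- interim partial proof (harness21 @ d8f2665), preserved for route work:
:= by
  refine ⟨isSound_textbookFrege, ?_⟩
  sorry
-/

end Textbook

/-! ### API -/

namespace FregeSystem

variable {F F₁ F₂ F₃ : FregeSystem} {Γ : Set (PropForm ℕ)} {π : List (PropForm ℕ)}
  {φ : PropForm ℕ}

/-- An instance of a sound rule is sound: if all premise instances are true under `τ` then so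
is the conclusion instance. [Cook–Reckhow 1979, §2 (Lemma: soundness under substitution)] [cite: CookReckhow1979, §2 (Lemma: soundness under substitution] -/
theorem _root_.Literature.Computability.MetaComplexity.FregeRule.IsSound.eval_subst {r : FregeRule} (hr : r.IsSound)
    (σ : ℕ → PropForm ℕ) (τ : ℕ → Bool)
    (h : ∀ p ∈ r.premises, (p.subst σ).eval τ = true) : (r.conclusion.subst σ).eval τ = true := by
  rw [PropForm.eval_subst]
  exact hr _ fun p hp => by rw [← PropForm.eval_subst]; exact h p hp

/-- The empty sequence is a derivation (from any hypotheses). [Cook–Reckhow 1979, §2] [cite: CookReckhow1979, §2] -/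
theorem isDerivation_nil (F : FregeSystem) (Γ : Set (PropForm ℕ)) : F.IsDerivation Γ [] :=
  fun k hk => absurd hk (Nat.not_lt_zero k)

/-- Derivations are monotone in the set of hypotheses. [Cook–Reckhow 1979, §2] [cite: CookReckhow1979, §2] -/
theorem IsDerivation.mono {Γ Γ' : Set (PropForm ℕ)} (h : F.IsDerivation Γ π) (hΓ : Γ ⊆ Γ') :
    F.IsDerivation Γ' π :=
  fun k hk => (h k hk).imp (fun hm => hΓ hm) id

/-- Concatenating two derivations from `Γ` gives a derivation from `Γ` (premises of the second
part are found further to the right in the longer prefix). [Cook–Reckhow 1979, §2;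
Buss 1998, §1.1] [cite: CookReckhow1979, §2] -/
theorem IsDerivation.append {π₁ π₂ : List (PropForm ℕ)} (h₁ : F.IsDerivation Γ π₁)
    (h₂ : F.IsDerivation Γ π₂) : F.IsDerivation Γ (π₁ ++ π₂) := by
  intro k hk
  by_cases hk₁ : k < π₁.length
  · rw [List.getElem_append_left hk₁, List.take_append_of_le_length hk₁.le]
    exact h₁ k hk₁
  · have hk₁ : π₁.length ≤ k := Nat.le_of_not_lt hk₁
    have hk₂ : k - π₁.length < π₂.length := by rw [List.length_append] at hk; omega
    rw [List.getElem_append_right hk₁, List.take_append]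
    rcases h₂ (k - π₁.length) hk₂ with hm | ⟨r, hr, σ, hc, hp⟩
    · exact Or.inl hm
    · exact Or.inr ⟨r, hr, σ, hc, fun p hpp => List.mem_append_right _ (hp p hpp)⟩

/-- **Soundness of Frege derivations**: every line of a derivation from `Γ` in a sound system is
a semantic consequence of `Γ`. [Cook–Reckhow 1979, §2 (soundness); Buss 1998, §1.1] [cite: CookReckhow1979, §2 (soundness] -/
theorem IsSound.eval_of_isDerivation (hF : F.IsSound) (h : F.IsDerivation Γ π) (τ : ℕ → Bool)
    (hΓ : ∀ ψ ∈ Γ, ψ.eval τ = true) : ∀ ψ ∈ π, ψ.eval τ = true := by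
  suffices H : ∀ (k : ℕ) (hk : k < π.length), π[k].eval τ = true by
    intro ψ hψ
    obtain ⟨k, hk, rfl⟩ := List.getElem_of_mem hψ
    exact H k hk
  intro k
  induction k using Nat.strong_induction_on with
  | _ k ih =>
    intro hk
    rcases h k hk with hm | ⟨r, hr, σ, hconc, hprem⟩
    · exact hΓ _ hm
    · rw [← hconc]
      refine (hF r hr).eval_subst σ τ fun p hp => ?_
      obtain ⟨j, hj, hj'⟩ := List.getElem_of_mem (hprem p hp)
      rw [List.length_take] at hj
      rw [← hj', List.getElem_take]
      exact ih j (by omega) (by omega)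

/-- **Soundness**: a formula with a proof in a sound Frege system is a tautology.
[Cook–Reckhow 1979, §2; Krajíček 1995, §4.4] [cite: CookReckhow1979, §2] -/
theorem IsSound.isTautology_of_isProofOf (hF : F.IsSound) (h : F.IsProofOf π φ) :
    φ.IsTautology := by
  intro τ
  have hmem : φ ∈ π := List.mem_of_getLast? h.2
  exact hF.eval_of_isDerivation h.1 τ (fun ψ hψ => absurd hψ (Set.notMem_empty ψ)) φ hmem

/-- Contrapositive of soundness: non-tautologies are not provable in a sound system.
[Cook–Reckhow 1979, §2] [cite: CookReckhow1979, §2] -/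
theorem IsSound.not_provable_of_not_isTautology (hF : F.IsSound) (h : ¬ φ.IsTautology) :
    ¬ F.Provable φ :=
  fun ⟨_, hπ⟩ => h (hF.isTautology_of_isProofOf hπ)

/-- In a Frege system, provability coincides with being a tautology (soundness and completeness
with `Γ = ∅`). [Cook–Reckhow 1979, §2] [cite: CookReckhow1979, §2] -/
theorem provable_iff_isTautology (hF : IsFrege F) : F.Provable φ ↔ φ.IsTautology := by
  refine ⟨fun ⟨π, hπ⟩ => hF.1.isTautology_of_isProofOf hπ, fun h => ?_⟩
  obtain ⟨π, hπ, hlast⟩ := hF.2 ∅ φ (fun σ _ => h σ)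
  exact ⟨π, hπ.mono (by simp), hlast⟩

/-- A Frege proof is an extended-Frege proof (using no extension axioms).
[Cook–Reckhow 1979, §4] [cite: CookReckhow1979, §4] -/
theorem IsProofOf.isEFProofOf (h : F.IsProofOf π φ) : F.IsEFProofOf π φ :=
  ⟨fun k hk => (h.1 k hk).elim (fun hm => absurd hm (Set.notMem_empty _)) Or.inl, h.2⟩

/-- Consequently a polynomially bounded Frege system has polynomially bounded extended Frege.
[Cook–Reckhow 1979, §4] [cite: CookReckhow1979, §4] -/
theorem IsPolyBounded.isEFPolyBounded (h : F.IsPolyBounded) : F.IsEFPolyBounded := by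
  obtain ⟨p, hp⟩ := h
  exact ⟨p, fun φ hφ => (hp φ hφ).imp fun π hπ => ⟨hπ.1.isEFProofOf, hπ.2⟩⟩

/-- A depth-`d` proof is in particular a proof. [Krajíček 1995, §4.3] [folklore] -/
theorem IsDepthProofOf.isProofOf {d : ℕ} (h : F.IsDepthProofOf d π φ) : F.IsProofOf π φ :=
  h.1

/-- Every proof is a depth-`d` proof for `d` its size (each line has depth at most its size,
`PropForm.altDepth_le_size`). [Krajíček 1995, §4.3] [folklore] -/
theorem IsProofOf.isDepthProofOf_proofSize (h : F.IsProofOf π φ) :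
    F.IsDepthProofOf (proofSize π) π φ := by
  refine ⟨h, fun ψ hψ => (PropForm.altDepth_le_size ψ).trans ?_⟩
  exact List.le_sum_of_mem (List.mem_map_of_mem hψ)

/-- p-simulation of Frege systems is reflexive (identity translation, `PolyTimeComputable.id`).
[Cook–Reckhow 1979, §1–2] [cite: CookReckhow1979, §1–2] -/
protected theorem PSimulates.refl (F : FregeSystem) : F.PSimulates F :=
  ⟨id, PolyTimeComputable.id _, fun _ _ h => h⟩

/-- p-simulation of Frege systems is transitive (compose the translations;
`PolyTimeComputable.comp`). [Cook–Reckhow 1979, §1–2] [cite: CookReckhow1979, §1–2] -/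
protected def PSimulates.trans : Prop :=
  ∀ (h₁₂ : F₁.PSimulates F₂) (h₂₃ : F₂.PSimulates F₃),
    F₁.PSimulates F₃

/- interim proof relied on results that are now named facts (D-0014); demoted to a fact by the M5 import, proof preserved:
:= by
  obtain ⟨f, hf, hf'⟩ := h₁₂
  obtain ⟨g, hg, hg'⟩ := h₂₃
  exact ⟨f ∘ g, hf.comp hg, fun π φ h => hf' _ _ (hg' π φ h)⟩
-/

/-- Polynomial boundedness transfers up a p-simulation: if `F₁` p-simulates `F₂` and `F₂` is
polynomially bounded then so is `F₁` (a polynomial-time translation has polynomially bounded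
output length, and `proofSize` is polynomially related to the encoding length of a proof whose
variables have been renamed into an initial segment). [Cook–Reckhow 1979, §1 (remark after
Def. 1.5), §2] [cite: CookReckhow1979, §1 (remark after Def. 1.5] -/
def IsPolyBounded.of_pSimulates : Prop :=
  ∀ (h : F₁.PSimulates F₂) (h₂ : F₂.IsPolyBounded),
    F₁.IsPolyBounded

end FregeSystem

/-- **Bridge to the abstract layer.** A Frege system `F` induces a Cook–Reckhow proof system
`V` for `TAUT` in verifier form (`V x π` accepts iff `x` encodes a formula `φ` via
`encodingPropForm` and `π` encodes, via `encodingPropForm.listBool`, an `F`-proof of `φ`;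
checking a line against finitely many rule schemes is polynomial-time matching), and `V` is
polynomially bounded iff `F` is.
Note on the `↔` (review finding 7): `F.IsPolyBounded` measures proofs by `proofSize`, the sum
of the node counts `PropForm.size` of the lines, and tautologies by `φ.size`, whereas
`CplxMeta.IsPolyBounded V` measures both in *encoding length*, and `encodingPropForm` spends
`O(log i)` bits on each occurrence of the variable `var i`; so the two measures are not
linearly related in general (a short proof may use huge variable indices). The equivalence
nevertheless holds because variables of a proof can be renamed into an initial segment
`{0, …, m-1}` with `m ≤ proofSize π` (plus those of `φ`) without affecting proofhood, after
which encoding length is `O(proofSize π · log (proofSize π + |x|))`; conversely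
`proofSize π ≤ |encode π|` and `φ.size ≤ |x|`. This is why the statement is a genuine
(`sorry`d) theorem and not `Iff.rfl`-like. [Cook–Reckhow 1979, §1–2 (Frege systems are proof
systems; Lemma on renaming variables); Krajíček 1995, §4.4] [cite: CookReckhow1979, §1–2 (Frege systems are proof systems] -/
def exists_isProofSystemFor_of_isFrege : Prop :=
  ∀ {F : FregeSystem} (hF : IsFrege F),
    ∃ V, IsProofSystemFor V TAUT ∧
      (Literature.Computability.MetaComplexity.IsPolyBounded V ↔ Literature.Computability.MetaComplexity.FregeSystem.IsPolyBounded F)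

/-- Hence a polynomially bounded Frege system yields a polynomially bounded abstract proof
system for `TAUT` (and so `NP = coNP` by Cook–Reckhow, cf.
`hasPolyBoundedProofSystem_iff_mem_NP`). [Cook–Reckhow 1979, §1–2] [cite: CookReckhow1979, §1–2] -/
def hasPolyBoundedProofSystem_TAUT_of_isPolyBounded : Prop :=
  ∀ {F : FregeSystem} (hF : IsFrege F) (h : F.IsPolyBounded),
    HasPolyBoundedProofSystem TAUT

/- interim proof relied on results that are now named facts (D-0014); demoted to a fact by the M5 import, proof preserved:
:= by
  obtain ⟨V, hV, hiff⟩ := exists_isProofSystemFor_of_isFrege hF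
  exact ⟨V, hV, hiff.2 h⟩
-/

end Literature.Computability.MetaComplexity
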